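import Summits.ValiantsHypothesis.ValiantsHypothesis.Theorems.LacunarySymmetroidMatrixDescartesPivotRankOneFourKillEight

/-!
# `MatrixDescartes` census — rank-one `(2,4)₁` in chamber (B): kill-eight + circuit trinomial, the TOP triples (C₂), (C₃)

HONEST FRAMING.  Object-search cell `pub-symmetroid`, seat `val-sym-mdr-p1` (generation 14); helper file `--supports` the crux item
stmt-ValiantsHypothesis-18050 (`Theses.LacunarySymmetroid.MatrixDescartes`, OPEN, on HOLD) with NO closure claim.  Companion of
`…PivotRankOneFourKillEight` (see its docstring for the method: kill the eight degrees other than a consecutive `(pair, negative, pair)`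
triple of the chamber-(B) order, then the circuit number of the surviving trinomial): here the two triples around the ABOVE-pivot
negative degrees,

* **(C₂)** triple `(d₀+d₃, e+d₂, d₁+d₃)`: `β = w₂|m₂|·Π`, `α = w₀w₃Δ₀₃²·Π`, `γ = w₁w₃Δ₁₃²·Π`, `p = e+d₂−d₀−d₃`, `q = d₁+d₃−e−d₂`
  (`elevenNomial_chamberB_C2_le_eight`, `rankOne_posRoots_le_eight_of_C2`; hypotheses `d₁+d₂ < 2e < d₀+d₃ < e+d₂ < d₁+d₃`) — letter `2`
  weakly core or `w₂` small;
* **(C₃)** triple `(d₁+d₃, e+d₃, d₂+d₃)`: `β = w₃|m₃|·Π`, `α = w₁w₃Δ₁₃²·Π`, `γ = w₂w₃Δ₂₃²·Π`, `p = e−d₁`, `q = d₂−e`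
  (`…_C3_…`; hypothesis `e+d₂ < d₁+d₃` only) — the top letter weakly core (the mirror of (C₀)).

With (C₀), (C₁), (C_J) these are the five weight-dependent «near-boundary» conditions of chamber (B); no covering is claimed.  Nothing
here bears on `MatrixDescartes` in its window, on `DoorA26` / `DoorA34`, registers / credences, or `VP ≠ VNP`.

[folklore] Tree engine (weighted Rolle) and the circuit number [cite: IlimanDewolff2016, Theorem 3.8 (n = 1)] via the tree lemma.  No
definitions, no named facts.
-/

-- `Summit.ValiantsHypothesis.ValiantsHypothesis.…` repeats a component by the D-0017 layout
-- (single-conjunct summit), which the `dupNamespace` linter flags; the name is mandated.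
set_option linter.dupNamespace false

namespace Summit.ValiantsHypothesis.ValiantsHypothesis.Theorems.LacunarySymmetroidMatrixDescartes.Pivot.TwoDirections.BlockLaw

open Polynomial Matrix Finset
open scoped BigOperators

/-! ## 1. (C₂): letter `2` weakly core -/

/-- **(C₂), real-parameter form.**  The chamber-(B) eleven-nomial (exponent hypotheses `d₁+d₂ < 2e < d₀+d₃ < e+d₂ < d₁+d₃` beyond the split; all coefficient data
arbitrary except the positivity of the two surviving pair coefficients) has at most EIGHT positive roots when the killed negative term of
letter `2` is below the circuit number of its two killed neighbours. -/
theorem elevenNomial_chamberB_C2_le_eight (e d₀ d₁ d₂ d₃ : ℕ) (h01 : d₀ < d₁) (h1e : d₁ < e) (he2 : e < d₂) (h23 : d₂ < d₃)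
    (hB2 : d₁ + d₂ < 2 * e) (hB3 : 2 * e < d₀ + d₃) (hB4 : d₀ + d₃ < e + d₂) (hB5 : e + d₂ < d₁ + d₃)
    (dJ m₀ m₁ m₂ m₃ w₀ w₁ w₂ w₃ D01 D02 D03 D12 D13 D23 : ℝ) (hw₀ : 0 < w₀) (hw₁ : 0 < w₁) (hw₃ : 0 < w₃) (hD03 : 0 < D03) (hD13 : 0 < D13)
    (hcirc : (w₂ * (-m₂)
        * (((d₂ : ℝ) - e) * ((d₂ : ℝ) - d₀) * ((d₂ : ℝ) - d₁) * ((d₃ : ℝ) - d₂) * ((e : ℝ) + d₂ - d₀ - d₁) * ((e : ℝ) - d₀) * ((e : ℝ) - d₁) * ((d₃ : ℝ) - e))) ^ ((e + d₂) - d₀ - d₃ + ((d₁ + d₃) - e - d₂)) * (((((d₁ + d₃) - e - d₂ : ℕ) : ℝ)) ^ ((d₁ + d₃) - e - d₂) * ((((e + d₂) - d₀ - d₃ : ℕ) : ℝ)) ^ ((e + d₂) - d₀ - d₃))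
      < ((((e + d₂) - d₀ - d₃ + ((d₁ + d₃) - e - d₂) : ℕ) : ℝ)) ^ ((e + d₂) - d₀ - d₃ + ((d₁ + d₃) - e - d₂))
        * ((w₀ * w₃ * D03
          * (((d₀ : ℝ) + d₃ - 2 * e) * ((d₃ : ℝ) - e) * ((d₀ : ℝ) + d₃ - e - d₁) * ((e : ℝ) - d₀) * ((d₃ : ℝ) - d₁) * ((d₃ : ℝ) - d₂) * ((d₀ : ℝ) + d₃ - d₁ - d₂) * ((d₂ : ℝ) - d₀))) ^ ((d₁ + d₃) - e - d₂)
          * (w₁ * w₃ * D13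
          * (((d₁ : ℝ) + d₃ - 2 * e) * ((d₁ : ℝ) + d₃ - e - d₀) * ((d₃ : ℝ) - e) * ((e : ℝ) - d₁) * ((d₃ : ℝ) - d₀) * ((d₁ : ℝ) + d₃ - d₀ - d₂) * ((d₃ : ℝ) - d₂) * ((d₂ : ℝ) - d₁))) ^ ((e + d₂) - d₀ - d₃))) :
    ((∑ i : Fin 11, Polynomial.C ((![dJ, w₀ * m₀, w₁ * m₁, w₂ * m₂, w₃ * m₃, w₀ * w₁ * D01, w₀ * w₂ * D02, w₀ * w₃ * D03, w₁ * w₂ * D12, w₁ * w₃ * D13, w₂ * w₃ * D23] : Fin 11 → ℝ) i) * X ^ ((![2 * e, e + d₀, e + d₁, e + d₂, e + d₃, d₀ + d₁, d₀ + d₂, d₀ + d₃, d₁ + d₂, d₁ + d₃, d₂ + d₃] : Fin 11 → ℕ) i)).roots.toFinset.filter (fun t => 0 < t)).card ≤ 8 := by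
  classical
  have h01' : (d₀ : ℝ) < d₁ := by exact_mod_cast h01
  have h1e' : (d₁ : ℝ) < e := by exact_mod_cast h1e
  have he2' : (e : ℝ) < d₂ := by exact_mod_cast he2
  have h23' : (d₂ : ℝ) < d₃ := by exact_mod_cast h23
  have hB2' : (d₁ : ℝ) + d₂ < 2 * e := by exact_mod_cast hB2
  have hB3' : 2 * (e : ℝ) < d₀ + d₃ := by exact_mod_cast hB3
  have hB4' : (d₀ : ℝ) + d₃ < e + d₂ := by exact_mod_cast hB4
  have hB5' : (e : ℝ) + d₂ < d₁ + d₃ := by exact_mod_cast hB5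
  -- the three distance products
  obtain ⟨PA, hPA⟩ : ∃ x : ℝ, x = ((d₀ : ℝ) + d₃ - 2 * e) * ((d₃ : ℝ) - e) * ((d₀ : ℝ) + d₃ - e - d₁) * ((e : ℝ) - d₀) * ((d₃ : ℝ) - d₁) * ((d₃ : ℝ) - d₂) * ((d₀ : ℝ) + d₃ - d₁ - d₂) * ((d₂ : ℝ) - d₀) := ⟨_, rfl⟩
  obtain ⟨PB, hPB⟩ : ∃ x : ℝ, x = ((d₂ : ℝ) - e) * ((d₂ : ℝ) - d₀) * ((d₂ : ℝ) - d₁) * ((d₃ : ℝ) - d₂) * ((e : ℝ) + d₂ - d₀ - d₁) * ((e : ℝ) - d₀) * ((e : ℝ) - d₁) * ((d₃ : ℝ) - e) := ⟨_, rfl⟩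
  obtain ⟨PC, hPC⟩ : ∃ x : ℝ, x = ((d₁ : ℝ) + d₃ - 2 * e) * ((d₁ : ℝ) + d₃ - e - d₀) * ((d₃ : ℝ) - e) * ((e : ℝ) - d₁) * ((d₃ : ℝ) - d₀) * ((d₁ : ℝ) + d₃ - d₀ - d₂) * ((d₃ : ℝ) - d₂) * ((d₂ : ℝ) - d₁) := ⟨_, rfl⟩
  have hPAp : 0 < PA := by
    rw [hPA]
    have f1 : 0 < ((d₀ : ℝ) + d₃ - 2 * e) := by linarith
    have f2 : 0 < ((d₃ : ℝ) - e) := by linarith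
    have f3 : 0 < ((d₀ : ℝ) + d₃ - e - d₁) := by linarith
    have f4 : 0 < ((e : ℝ) - d₀) := by linarith
    have f5 : 0 < ((d₃ : ℝ) - d₁) := by linarith
    have f6 : 0 < ((d₃ : ℝ) - d₂) := by linarith
    have f7 : 0 < ((d₀ : ℝ) + d₃ - d₁ - d₂) := by linarith
    have f8 : 0 < ((d₂ : ℝ) - d₀) := by linarith
    exact mul_pos (mul_pos (mul_pos (mul_pos (mul_pos (mul_pos (mul_pos f1 f2) f3) f4) f5) f6) f7) f8
  have hPCp : 0 < PC := by
    rw [hPC]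
    have f1 : 0 < ((d₁ : ℝ) + d₃ - 2 * e) := by linarith
    have f2 : 0 < ((d₁ : ℝ) + d₃ - e - d₀) := by linarith
    have f3 : 0 < ((d₃ : ℝ) - e) := by linarith
    have f4 : 0 < ((e : ℝ) - d₁) := by linarith
    have f5 : 0 < ((d₃ : ℝ) - d₀) := by linarith
    have f6 : 0 < ((d₁ : ℝ) + d₃ - d₀ - d₂) := by linarith
    have f7 : 0 < ((d₃ : ℝ) - d₂) := by linarith
    have f8 : 0 < ((d₂ : ℝ) - d₁) := by linarith
    exact mul_pos (mul_pos (mul_pos (mul_pos (mul_pos (mul_pos (mul_pos f1 f2) f3) f4) f5) f6) f7) f8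
  -- the three surviving coefficients
  obtain ⟨A, hA⟩ : ∃ x : ℝ, x = w₀ * w₃ * D03 * PA := ⟨_, rfl⟩
  obtain ⟨B, hB⟩ : ∃ x : ℝ, x = w₂ * (-m₂) * PB := ⟨_, rfl⟩
  obtain ⟨C, hC⟩ : ∃ x : ℝ, x = w₁ * w₃ * D13 * PC := ⟨_, rfl⟩
  have hAp : 0 < A := by rw [hA]; exact mul_pos (mul_pos (mul_pos hw₀ hw₃) hD03) hPAp
  have hCp : 0 < C := by rw [hC]; exact mul_pos (mul_pos (mul_pos hw₁ hw₃) hD13) hPCp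
  have hcirc' : B ^ ((e + d₂) - d₀ - d₃ + ((d₁ + d₃) - e - d₂)) * (((((d₁ + d₃) - e - d₂ : ℕ) : ℝ)) ^ ((d₁ + d₃) - e - d₂) * ((((e + d₂) - d₀ - d₃ : ℕ) : ℝ)) ^ ((e + d₂) - d₀ - d₃)) < ((((e + d₂) - d₀ - d₃ + ((d₁ + d₃) - e - d₂) : ℕ) : ℝ)) ^ ((e + d₂) - d₀ - d₃ + ((d₁ + d₃) - e - d₂)) * (A ^ ((d₁ + d₃) - e - d₂) * C ^ ((e + d₂) - d₀ - d₃)) := by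
    rw [hA, hB, hC, hPA, hPB, hPC]; exact hcirc
  clear hcirc
  -- eight kills
  have hkills := card_posRoots_le_kills (Finset.univ : Finset (Fin 11)) (![2 * e, e + d₀, e + d₁, e + d₂, e + d₃, d₀ + d₁, d₀ + d₂, d₀ + d₃, d₁ + d₂, d₁ + d₃, d₂ + d₃] : Fin 11 → ℕ) [2 * e, e + d₀, e + d₁, e + d₃, d₀ + d₁, d₀ + d₂, d₁ + d₂, d₂ + d₃] (![dJ, w₀ * m₀, w₁ * m₁, w₂ * m₂, w₃ * m₃, w₀ * w₁ * D01, w₀ * w₂ * D02, w₀ * w₃ * D03, w₁ * w₂ * D12, w₁ * w₃ * D13, w₂ * w₃ * D23] : Fin 11 → ℝ)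
  have htri : (∑ i ∈ (Finset.univ : Finset (Fin 11)), Polynomial.C ((![dJ, w₀ * m₀, w₁ * m₁, w₂ * m₂, w₃ * m₃, w₀ * w₁ * D01, w₀ * w₂ * D02, w₀ * w₃ * D03, w₁ * w₂ * D12, w₁ * w₃ * D13, w₂ * w₃ * D23] : Fin 11 → ℝ) i
          * (([2 * e, e + d₀, e + d₁, e + d₃, d₀ + d₁, d₀ + d₂, d₁ + d₂, d₂ + d₃]).map (fun ρ : ℕ => (((((![2 * e, e + d₀, e + d₁, e + d₂, e + d₃, d₀ + d₁, d₀ + d₂, d₀ + d₃, d₁ + d₂, d₁ + d₃, d₂ + d₃] : Fin 11 → ℕ)) i : ℕ) : ℝ) - (ρ : ℝ)))).prod) * X ^ ((![2 * e, e + d₀, e + d₁, e + d₂, e + d₃, d₀ + d₁, d₀ + d₂, d₀ + d₃, d₁ + d₂, d₁ + d₃, d₂ + d₃] : Fin 11 → ℕ) i))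
      = (Polynomial.C A * X ^ (d₀ + d₃) - Polynomial.C B * X ^ (d₀ + d₃ + ((e + d₂) - d₀ - d₃)) + Polynomial.C C * X ^ (d₀ + d₃ + ((e + d₂) - d₀ - d₃) + ((d₁ + d₃) - e - d₂))) := by
    have e1 : d₀ + d₃ + ((e + d₂) - d₀ - d₃) = e + d₂ := by omega
    have e2 : d₀ + d₃ + ((e + d₂) - d₀ - d₃) + ((d₁ + d₃) - e - d₂) = d₁ + d₃ := by omega
    rw [e2, e1]
    have hcoef : ∀ i : Fin 11, (![dJ, w₀ * m₀, w₁ * m₁, w₂ * m₂, w₃ * m₃, w₀ * w₁ * D01, w₀ * w₂ * D02, w₀ * w₃ * D03, w₁ * w₂ * D12, w₁ * w₃ * D13, w₂ * w₃ * D23] : Fin 11 → ℝ) i * (([2 * e, e + d₀, e + d₁, e + d₃, d₀ + d₁, d₀ + d₂, d₁ + d₂, d₂ + d₃]).map (fun ρ : ℕ => (((((![2 * e, e + d₀, e + d₁, e + d₂, e + d₃, d₀ + d₁, d₀ + d₂, d₀ + d₃, d₁ + d₂, d₁ + d₃, d₂ + d₃] : Fin 11 → ℕ)) i : ℕ) :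 ℝ) - (ρ : ℝ)))).prod
        = (![0, 0, 0, -B, 0, 0, 0, A, 0, C, 0] : Fin 11 → ℝ) i := by
      intro i
      fin_cases i <;>
        simp only [Fin.zero_eta, Fin.mk_one, Fin.isValue, Matrix.cons_val_zero, Matrix.cons_val_one,
          List.map_cons, List.map_nil, List.prod_cons, List.prod_nil, hA, hB, hC, hPA, hPB, hPC] <;>
        push_cast <;> ring
    rw [Finset.sum_congr rfl (fun i _ => by rw [hcoef i])]
    simp only [Fin.sum_univ_succ, Fin.sum_univ_zero, Matrix.cons_val_zero, Matrix.cons_val_succ, map_zero, zero_mul,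
      zero_add, add_zero, Polynomial.C_neg]
    ring
  rw [htri] at hkills
  have hzero := card_posRoots_trinomial_eq_zero_of_circuit A B C (d₀ + d₃) ((e + d₂) - d₀ - d₃) ((d₁ + d₃) - e - d₂) hAp hCp (by omega) (by omega) (Or.inr hcirc')
  simp only [List.length_cons, List.length_nil] at hkills
  omega

/-- **RANK-ONE `(2,4)₁` IN CHAMBER (B): `Z₊ ≤ 8` under (C₂)** (matrix form; `J` arbitrary, `w₀, w₁, w₂, w₃ > 0`, letters `0,3` and `1,3` not parallel). [this file] -/
theorem rankOne_posRoots_le_eight_of_C2 (e d₀ d₁ d₂ d₃ : ℕ) (h01 : d₀ < d₁) (h1e : d₁ < e) (he2 : e < d₂) (h23 : d₂ < d₃)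
    (hB2 : d₁ + d₂ < 2 * e) (hB3 : 2 * e < d₀ + d₃) (hB4 : d₀ + d₃ < e + d₂) (hB5 : e + d₂ < d₁ + d₃)
    (J : Matrix (Fin 2) (Fin 2) ℝ) (v₀ v₁ v₂ v₃ : Fin 2 → ℝ) (w₀ w₁ w₂ w₃ : ℝ) (hw₀ : 0 < w₀) (hw₁ : 0 < w₁) (hw₃ : 0 < w₃) (hv03 : v₀ 0 * v₃ 1 - v₀ 1 * v₃ 0 ≠ 0) (hv13 : v₁ 0 * v₃ 1 - v₁ 1 * v₃ 0 ≠ 0)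
    (hcirc : (w₂ * (-(J 0 0 * v₂ 1 ^ 2 + J 1 1 * v₂ 0 ^ 2 - (J 0 1 + J 1 0) * (v₂ 0 * v₂ 1)))
        * (((d₂ : ℝ) - e) * ((d₂ : ℝ) - d₀) * ((d₂ : ℝ) - d₁) * ((d₃ : ℝ) - d₂) * ((e : ℝ) + d₂ - d₀ - d₁) * ((e : ℝ) - d₀) * ((e : ℝ) - d₁) * ((d₃ : ℝ) - e))) ^ ((e + d₂) - d₀ - d₃ + ((d₁ + d₃) - e - d₂)) * (((((d₁ + d₃) - e - d₂ : ℕ) : ℝ)) ^ ((d₁ + d₃) - e - d₂) * ((((e + d₂) - d₀ - d₃ : ℕ) : ℝ)) ^ ((e + d₂) - d₀ - d₃))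
      < ((((e + d₂) - d₀ - d₃ + ((d₁ + d₃) - e - d₂) : ℕ) : ℝ)) ^ ((e + d₂) - d₀ - d₃ + ((d₁ + d₃) - e - d₂))
        * ((w₀ * w₃ * ((v₀ 0 * v₃ 1 - v₀ 1 * v₃ 0) ^ 2)
          * (((d₀ : ℝ) + d₃ - 2 * e) * ((d₃ : ℝ) - e) * ((d₀ : ℝ) + d₃ - e - d₁) * ((e : ℝ) - d₀) * ((d₃ : ℝ) - d₁) * ((d₃ : ℝ) - d₂) * ((d₀ : ℝ) + d₃ - d₁ - d₂) * ((d₂ : ℝ) - d₀))) ^ ((d₁ + d₃) - e - d₂)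
          * (w₁ * w₃ * ((v₁ 0 * v₃ 1 - v₁ 1 * v₃ 0) ^ 2)
          * (((d₁ : ℝ) + d₃ - 2 * e) * ((d₁ : ℝ) + d₃ - e - d₀) * ((d₃ : ℝ) - e) * ((e : ℝ) - d₁) * ((d₃ : ℝ) - d₀) * ((d₁ : ℝ) + d₃ - d₀ - d₂) * ((d₃ : ℝ) - d₂) * ((d₂ : ℝ) - d₁))) ^ ((e + d₂) - d₀ - d₃))) :
    ((Matrix.det (((X : ℝ[X]) ^ e) • J.map Polynomial.C
        + (Polynomial.C w₀ * X ^ d₀) • (vecMulVec v₀ v₀).map Polynomial.C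
        + (Polynomial.C w₁ * X ^ d₁) • (vecMulVec v₁ v₁).map Polynomial.C
        + (Polynomial.C w₂ * X ^ d₂) • (vecMulVec v₂ v₂).map Polynomial.C
        + (Polynomial.C w₃ * X ^ d₃) • (vecMulVec v₃ v₃).map Polynomial.C)).roots.toFinset.filter (fun t => 0 < t)).card
      ≤ 8 := by
  rw [det_rankOne_four_sum]
  exact elevenNomial_chamberB_C2_le_eight e d₀ d₁ d₂ d₃ h01 h1e he2 h23 hB2 hB3 hB4 hB5 J.det _ _ _ _ w₀ w₁ w₂ w₃ _ _ _ _ _ _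
    hw₀ hw₁ hw₃ (by positivity) (by positivity) hcirc

/-! ## 2. (C₃): the top letter weakly core -/

/-- **(C₃), real-parameter form.**  The chamber-(B) eleven-nomial (exponent hypotheses `e+d₂ < d₁+d₃` beyond the split; all coefficient data
arbitrary except the positivity of the two surviving pair coefficients) has at most EIGHT positive roots when the killed negative term of
letter `3` (the top letter) is below the circuit number of its two killed neighbours. -/
theorem elevenNomial_chamberB_C3_le_eight (e d₀ d₁ d₂ d₃ : ℕ) (h01 : d₀ < d₁) (h1e : d₁ < e) (he2 : e < d₂) (h23 : d₂ < d₃)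
    (hB5 : e + d₂ < d₁ + d₃)
    (dJ m₀ m₁ m₂ m₃ w₀ w₁ w₂ w₃ D01 D02 D03 D12 D13 D23 : ℝ) (hw₁ : 0 < w₁) (hw₂ : 0 < w₂) (hw₃ : 0 < w₃) (hD13 : 0 < D13) (hD23 : 0 < D23)
    (hcirc : (w₃ * (-m₃)
        * (((d₃ : ℝ) - e) * ((d₃ : ℝ) - d₀) * ((d₃ : ℝ) - d₁) * ((d₃ : ℝ) - d₂) * ((e : ℝ) + d₃ - d₀ - d₁) * ((e : ℝ) + d₃ - d₀ - d₂) * ((e : ℝ) - d₀) * ((e : ℝ) + d₃ - d₁ - d₂))) ^ (e - d₁ + (d₂ - e)) * ((((d₂ - e : ℕ) : ℝ)) ^ (d₂ - e) * (((e - d₁ : ℕ) : ℝ)) ^ (e - d₁))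
      < (((e - d₁ + (d₂ - e) : ℕ) : ℝ)) ^ (e - d₁ + (d₂ - e))
        * ((w₁ * w₃ * D13
          * (((d₁ : ℝ) + d₃ - 2 * e) * ((d₁ : ℝ) + d₃ - e - d₀) * ((d₃ : ℝ) - e) * ((d₁ : ℝ) + d₃ - e - d₂) * ((d₃ : ℝ) - d₀) * ((d₁ : ℝ) + d₃ - d₀ - d₂) * ((d₁ : ℝ) - d₀) * ((d₃ : ℝ) - d₂))) ^ (d₂ - e)
          * (w₂ * w₃ * D23
          * (((d₂ : ℝ) + d₃ - 2 * e) * ((d₂ : ℝ) + d₃ - e - d₀) * ((d₂ : ℝ) + d₃ - e - d₁) * ((d₃ : ℝ) - e) * ((d₂ : ℝ) + d₃ - d₀ - d₁) * ((d₃ : ℝ) - d₀) * ((d₂ : ℝ) - d₀) * ((d₃ : ℝ) - d₁))) ^ (e - d₁))) :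
    ((∑ i : Fin 11, Polynomial.C ((![dJ, w₀ * m₀, w₁ * m₁, w₂ * m₂, w₃ * m₃, w₀ * w₁ * D01, w₀ * w₂ * D02, w₀ * w₃ * D03, w₁ * w₂ * D12, w₁ * w₃ * D13, w₂ * w₃ * D23] : Fin 11 → ℝ) i) * X ^ ((![2 * e, e + d₀, e + d₁, e + d₂, e + d₃, d₀ + d₁, d₀ + d₂, d₀ + d₃, d₁ + d₂, d₁ + d₃, d₂ + d₃] : Fin 11 → ℕ) i)).roots.toFinset.filter (fun t => 0 < t)).card ≤ 8 := by
  classical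
  have h01' : (d₀ : ℝ) < d₁ := by exact_mod_cast h01
  have h1e' : (d₁ : ℝ) < e := by exact_mod_cast h1e
  have he2' : (e : ℝ) < d₂ := by exact_mod_cast he2
  have h23' : (d₂ : ℝ) < d₃ := by exact_mod_cast h23
  have hB5' : (e : ℝ) + d₂ < d₁ + d₃ := by exact_mod_cast hB5
  -- the three distance products
  obtain ⟨PA, hPA⟩ : ∃ x : ℝ, x = ((d₁ : ℝ) + d₃ - 2 * e) * ((d₁ : ℝ) + d₃ - e - d₀) * ((d₃ : ℝ) - e) * ((d₁ : ℝ) + d₃ - e - d₂) * ((d₃ : ℝ) - d₀) * ((d₁ : ℝ) + d₃ - d₀ - d₂) * ((d₁ : ℝ) - d₀) * ((d₃ : ℝ) - d₂) := ⟨_, rfl⟩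
  obtain ⟨PB, hPB⟩ : ∃ x : ℝ, x = ((d₃ : ℝ) - e) * ((d₃ : ℝ) - d₀) * ((d₃ : ℝ) - d₁) * ((d₃ : ℝ) - d₂) * ((e : ℝ) + d₃ - d₀ - d₁) * ((e : ℝ) + d₃ - d₀ - d₂) * ((e : ℝ) - d₀) * ((e : ℝ) + d₃ - d₁ - d₂) := ⟨_, rfl⟩
  obtain ⟨PC, hPC⟩ : ∃ x : ℝ, x = ((d₂ : ℝ) + d₃ - 2 * e) * ((d₂ : ℝ) + d₃ - e - d₀) * ((d₂ : ℝ) + d₃ - e - d₁) * ((d₃ : ℝ) - e) * ((d₂ : ℝ) + d₃ - d₀ - d₁) * ((d₃ : ℝ) - d₀) * ((d₂ : ℝ) - d₀) * ((d₃ : ℝ) - d₁) := ⟨_, rfl⟩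
  have hPAp : 0 < PA := by
    rw [hPA]
    have f1 : 0 < ((d₁ : ℝ) + d₃ - 2 * e) := by linarith
    have f2 : 0 < ((d₁ : ℝ) + d₃ - e - d₀) := by linarith
    have f3 : 0 < ((d₃ : ℝ) - e) := by linarith
    have f4 : 0 < ((d₁ : ℝ) + d₃ - e - d₂) := by linarith
    have f5 : 0 < ((d₃ : ℝ) - d₀) := by linarith
    have f6 : 0 < ((d₁ : ℝ) + d₃ - d₀ - d₂) := by linarith
    have f7 : 0 < ((d₁ : ℝ) - d₀) := by linarith
    have f8 : 0 < ((d₃ : ℝ) - d₂) := by linarith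
    exact mul_pos (mul_pos (mul_pos (mul_pos (mul_pos (mul_pos (mul_pos f1 f2) f3) f4) f5) f6) f7) f8
  have hPCp : 0 < PC := by
    rw [hPC]
    have f1 : 0 < ((d₂ : ℝ) + d₃ - 2 * e) := by linarith
    have f2 : 0 < ((d₂ : ℝ) + d₃ - e - d₀) := by linarith
    have f3 : 0 < ((d₂ : ℝ) + d₃ - e - d₁) := by linarith
    have f4 : 0 < ((d₃ : ℝ) - e) := by linarith
    have f5 : 0 < ((d₂ : ℝ) + d₃ - d₀ - d₁) := by linarith
    have f6 : 0 < ((d₃ : ℝ) - d₀) := by linarith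
    have f7 : 0 < ((d₂ : ℝ) - d₀) := by linarith
    have f8 : 0 < ((d₃ : ℝ) - d₁) := by linarith
    exact mul_pos (mul_pos (mul_pos (mul_pos (mul_pos (mul_pos (mul_pos f1 f2) f3) f4) f5) f6) f7) f8
  -- the three surviving coefficients
  obtain ⟨A, hA⟩ : ∃ x : ℝ, x = w₁ * w₃ * D13 * PA := ⟨_, rfl⟩
  obtain ⟨B, hB⟩ : ∃ x : ℝ, x = w₃ * (-m₃) * PB := ⟨_, rfl⟩
  obtain ⟨C, hC⟩ : ∃ x : ℝ, x = w₂ * w₃ * D23 * PC := ⟨_, rfl⟩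
  have hAp : 0 < A := by rw [hA]; exact mul_pos (mul_pos (mul_pos hw₁ hw₃) hD13) hPAp
  have hCp : 0 < C := by rw [hC]; exact mul_pos (mul_pos (mul_pos hw₂ hw₃) hD23) hPCp
  have hcirc' : B ^ (e - d₁ + (d₂ - e)) * ((((d₂ - e : ℕ) : ℝ)) ^ (d₂ - e) * (((e - d₁ : ℕ) : ℝ)) ^ (e - d₁)) < (((e - d₁ + (d₂ - e) : ℕ) : ℝ)) ^ (e - d₁ + (d₂ - e)) * (A ^ (d₂ - e) * C ^ (e - d₁)) := by
    rw [hA, hB, hC, hPA, hPB, hPC]; exact hcirc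
  clear hcirc
  -- eight kills
  have hkills := card_posRoots_le_kills (Finset.univ : Finset (Fin 11)) (![2 * e, e + d₀, e + d₁, e + d₂, e + d₃, d₀ + d₁, d₀ + d₂, d₀ + d₃, d₁ + d₂, d₁ + d₃, d₂ + d₃] : Fin 11 → ℕ) [2 * e, e + d₀, e + d₁, e + d₂, d₀ + d₁, d₀ + d₂, d₀ + d₃, d₁ + d₂] (![dJ, w₀ * m₀, w₁ * m₁, w₂ * m₂, w₃ * m₃, w₀ * w₁ * D01, w₀ * w₂ * D02, w₀ * w₃ * D03, w₁ * w₂ * D12, w₁ * w₃ * D13, w₂ * w₃ * D23] : Fin 11 → ℝ)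
  have htri : (∑ i ∈ (Finset.univ : Finset (Fin 11)), Polynomial.C ((![dJ, w₀ * m₀, w₁ * m₁, w₂ * m₂, w₃ * m₃, w₀ * w₁ * D01, w₀ * w₂ * D02, w₀ * w₃ * D03, w₁ * w₂ * D12, w₁ * w₃ * D13, w₂ * w₃ * D23] : Fin 11 → ℝ) i
          * (([2 * e, e + d₀, e + d₁, e + d₂, d₀ + d₁, d₀ + d₂, d₀ + d₃, d₁ + d₂]).map (fun ρ : ℕ => (((((![2 * e, e + d₀, e + d₁, e + d₂, e + d₃, d₀ + d₁, d₀ + d₂, d₀ + d₃, d₁ + d₂, d₁ + d₃, d₂ + d₃] : Fin 11 → ℕ)) i : ℕ) : ℝ) - (ρ : ℝ)))).prod) * X ^ ((![2 * e, e + d₀, e + d₁, e + d₂, e + d₃, d₀ + d₁, d₀ + d₂, d₀ + d₃, d₁ + d₂, d₁ + d₃, d₂ + d₃] : Fin 11 → ℕ) i))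
      = (Polynomial.C A * X ^ (d₁ + d₃) - Polynomial.C B * X ^ (d₁ + d₃ + (e - d₁)) + Polynomial.C C * X ^ (d₁ + d₃ + (e - d₁) + (d₂ - e))) := by
    have e1 : d₁ + d₃ + (e - d₁) = e + d₃ := by omega
    have e2 : d₁ + d₃ + (e - d₁) + (d₂ - e) = d₂ + d₃ := by omega
    rw [e2, e1]
    have hcoef : ∀ i : Fin 11, (![dJ, w₀ * m₀, w₁ * m₁, w₂ * m₂, w₃ * m₃, w₀ * w₁ * D01, w₀ * w₂ * D02, w₀ * w₃ * D03, w₁ * w₂ * D12, w₁ * w₃ * D13, w₂ * w₃ * D23] : Fin 11 → ℝ) i * (([2 * e, e + d₀, e + d₁, e + d₂, d₀ + d₁, d₀ + d₂, d₀ + d₃, d₁ + d₂]).map (fun ρ : ℕ => (((((![2 * e, e + d₀, e + d₁, e + d₂, e + d₃, d₀ + d₁, d₀ + d₂, d₀ + d₃, d₁ + d₂, d₁ + d₃, d₂ + d₃] : Fin 11 → ℕ)) i : ℕ) : ℝ) - (ρ : ℝ)))).prod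
        = (![0, 0, 0, 0, -B, 0, 0, 0, 0, A, C] : Fin 11 → ℝ) i := by
      intro i
      fin_cases i <;>
        simp only [Fin.zero_eta, Fin.mk_one, Fin.isValue, Matrix.cons_val_zero, Matrix.cons_val_one,
          List.map_cons, List.map_nil, List.prod_cons, List.prod_nil, hA, hB, hC, hPA, hPB, hPC] <;>
        push_cast <;> ring
    rw [Finset.sum_congr rfl (fun i _ => by rw [hcoef i])]
    simp only [Fin.sum_univ_succ, Fin.sum_univ_zero, Matrix.cons_val_zero, Matrix.cons_val_succ, map_zero, zero_mul,
      zero_add, add_zero, Polynomial.C_neg]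
    ring
  rw [htri] at hkills
  have hzero := card_posRoots_trinomial_eq_zero_of_circuit A B C (d₁ + d₃) (e - d₁) (d₂ - e) hAp hCp (by omega) (by omega) (Or.inr hcirc')
  simp only [List.length_cons, List.length_nil] at hkills
  omega

/-- **RANK-ONE `(2,4)₁` IN CHAMBER (B): `Z₊ ≤ 8` under (C₃)** (matrix form; `J` arbitrary, `w₁, w₂, w₃ > 0`, letters `1,3` and `2,3` not parallel). [this file] -/
theorem rankOne_posRoots_le_eight_of_C3 (e d₀ d₁ d₂ d₃ : ℕ) (h01 : d₀ < d₁) (h1e : d₁ < e) (he2 : e < d₂) (h23 : d₂ < d₃)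
    (hB5 : e + d₂ < d₁ + d₃)
    (J : Matrix (Fin 2) (Fin 2) ℝ) (v₀ v₁ v₂ v₃ : Fin 2 → ℝ) (w₀ w₁ w₂ w₃ : ℝ) (hw₁ : 0 < w₁) (hw₂ : 0 < w₂) (hw₃ : 0 < w₃) (hv13 : v₁ 0 * v₃ 1 - v₁ 1 * v₃ 0 ≠ 0) (hv23 : v₂ 0 * v₃ 1 - v₂ 1 * v₃ 0 ≠ 0)
    (hcirc : (w₃ * (-(J 0 0 * v₃ 1 ^ 2 + J 1 1 * v₃ 0 ^ 2 - (J 0 1 + J 1 0) * (v₃ 0 * v₃ 1)))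
        * (((d₃ : ℝ) - e) * ((d₃ : ℝ) - d₀) * ((d₃ : ℝ) - d₁) * ((d₃ : ℝ) - d₂) * ((e : ℝ) + d₃ - d₀ - d₁) * ((e : ℝ) + d₃ - d₀ - d₂) * ((e : ℝ) - d₀) * ((e : ℝ) + d₃ - d₁ - d₂))) ^ (e - d₁ + (d₂ - e)) * ((((d₂ - e : ℕ) : ℝ)) ^ (d₂ - e) * (((e - d₁ : ℕ) : ℝ)) ^ (e - d₁))
      < (((e - d₁ + (d₂ - e) : ℕ) : ℝ)) ^ (e - d₁ + (d₂ - e))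
        * ((w₁ * w₃ * ((v₁ 0 * v₃ 1 - v₁ 1 * v₃ 0) ^ 2)
          * (((d₁ : ℝ) + d₃ - 2 * e) * ((d₁ : ℝ) + d₃ - e - d₀) * ((d₃ : ℝ) - e) * ((d₁ : ℝ) + d₃ - e - d₂) * ((d₃ : ℝ) - d₀) * ((d₁ : ℝ) + d₃ - d₀ - d₂) * ((d₁ : ℝ) - d₀) * ((d₃ : ℝ) - d₂))) ^ (d₂ - e)
          * (w₂ * w₃ * ((v₂ 0 * v₃ 1 - v₂ 1 * v₃ 0) ^ 2)
          * (((d₂ : ℝ) + d₃ - 2 * e) * ((d₂ : ℝ) + d₃ - e - d₀) * ((d₂ : ℝ) + d₃ - e - d₁) * ((d₃ : ℝ) - e) * ((d₂ : ℝ) + d₃ - d₀ - d₁) * ((d₃ : ℝ) - d₀) * ((d₂ : ℝ) - d₀) * ((d₃ : ℝ) - d₁))) ^ (e - d₁))) :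
    ((Matrix.det (((X : ℝ[X]) ^ e) • J.map Polynomial.C
        + (Polynomial.C w₀ * X ^ d₀) • (vecMulVec v₀ v₀).map Polynomial.C
        + (Polynomial.C w₁ * X ^ d₁) • (vecMulVec v₁ v₁).map Polynomial.C
        + (Polynomial.C w₂ * X ^ d₂) • (vecMulVec v₂ v₂).map Polynomial.C
        + (Polynomial.C w₃ * X ^ d₃) • (vecMulVec v₃ v₃).map Polynomial.C)).roots.toFinset.filter (fun t => 0 < t)).card
      ≤ 8 := by
  rw [det_rankOne_four_sum]
  exact elevenNomial_chamberB_C3_le_eight e d₀ d₁ d₂ d₃ h01 h1e he2 h23 hB5 J.det _ _ _ _ w₀ w₁ w₂ w₃ _ _ _ _ _ _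
    hw₁ hw₂ hw₃ (by positivity) (by positivity) hcirc

end Summit.ValiantsHypothesis.ValiantsHypothesis.Theorems.LacunarySymmetroidMatrixDescartes.Pivot.TwoDirections.BlockLaw
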